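import Literature.Probability.LatticeModels.KCTouchReach
import HarnessLib

/-!
# The frozen skeleton of a hole-free free set is path connected

Topic `Literature/Probability/LatticeModels`. In the lattice sign-condition argument
(Chelkak–Smirnov 2012, proof of Thm. 6.1; `KCTouchReach.lean`, `KCSignConditionLattice.lean`)
the contour `C` runs between two frozen sites `a₁*`, `a₂*`; to certify that the region `D` of
plaquettes reachable from the seed stays on its side of `C` we close `C` up by a path INSIDE THE
FROZEN SKELETON `frozenSkeleton Λ` (which touching steps never cross) and apply the winding-number
certificate `Literature.Topology.PlaneTopology.exists_mem_of_straightCross`. This file supplies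
the closing path:

* `exists_forall_apply_one_lt` — a finite free set lies below some height;
* `reflTransGen_faceStep_of_holeFree` — **the frozen sites of a hole-free finite free set form a
  connected graph**: any two frozen sites are joined by a chain of lattice steps through frozen
  sites (each climbs above the free set by hole-freeness, and everything up there is frozen);
* `toComplex_mem_frozenSkeleton` — a frozen site of a hole-free free set lies on the skeleton;
* **`exists_path_frozenSkeleton`** — any two frozen sites are joined by a continuous planar path
  inside `frozenSkeleton Λ` (the polygonal realisation of the chain).

All `[folklore]`; no named fact.

## References

* D. Chelkak, S. Smirnov, Invent. Math. 189 (2012) = arXiv:0910.2045, proof of Thm. 6.1. [ChelkakSmirnov2012Ising]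
* S. Smirnov, Ann. of Math. 172 (2010), §3 (simply connected lattice domains). [Smirnov2010]
-/

noncomputable section

open Set

namespace Literature.Probability.LatticeModels

open Site

/-- A finite set of sites lies strictly below some height. [folklore] -/
theorem exists_forall_apply_one_lt (Λ : Finset (Site 2)) : ∃ M : ℤ, ∀ v ∈ Λ, v 1 < M := by
  obtain ⟨M, hM⟩ := (Λ.image fun v : Site 2 => v 1).bddAbove
  refine ⟨M + 1, fun v hv => ?_⟩
  have := hM (Finset.mem_coe.2 (Finset.mem_image_of_mem _ hv))
  omega

/-- Climbing from a frozen site of height `≥ M` (everything from height `M` on being frozen) to any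
greater height and then walking horizontally keeps face-step reachability. [folklore] -/
theorem reflTransGen_faceStep_climb {Λ : Finset (Site 2)} {M : ℤ} (hM : ∀ v ∈ Λ, v 1 < M) {g r : Site 2} (hg : g ∉ (Λ : Set (Site 2)))
    (h : Relation.ReflTransGen (FaceStep (Λ : Set (Site 2))) g r) (hr : M ≤ r 1) (n : ℕ) :
    Relation.ReflTransGen (FaceStep (Λ : Set (Site 2))) g (r + n • cornerUnit 1) :=
  reflTransGen_faceStep_nsmul hg h 1 (fun m hm => by
    have := hM _ hm
    simp [Pi.add_apply] at this
    omega) n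

/-- Walking horizontally at a height `≥ M` keeps face-step reachability. [folklore] -/
theorem reflTransGen_faceStep_horizontal {Λ : Finset (Site 2)} {M : ℤ} (hM : ∀ v ∈ Λ, v 1 < M) {g r : Site 2}
    (hg : g ∉ (Λ : Set (Site 2))) (h : Relation.ReflTransGen (FaceStep (Λ : Set (Site 2))) g r) (hr : M ≤ r 1)
    (k : Fin 4) (hk : k = 0 ∨ k = 2) (n : ℕ) :
    Relation.ReflTransGen (FaceStep (Λ : Set (Site 2))) g (r + n • cornerUnit k) :=
  reflTransGen_faceStep_nsmul hg h k (fun m hm => by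
    have := hM _ hm
    rcases hk with rfl | rfl <;> simp [Pi.add_apply] at this <;> omega) n

/-- **The frozen sites of a hole-free finite free set form a connected graph.** [cite: Smirnov2010, §3 (simply connected lattice domains)] -/
theorem reflTransGen_faceStep_of_holeFree {Λ : Finset (Site 2)} (hΛ : HoleFree (Λ : Set (Site 2))) {a₁ a₂ : Site 2}
    (h₁ : a₁ ∉ Λ) (h₂ : a₂ ∉ Λ) : Relation.ReflTransGen (FaceStep (Λ : Set (Site 2))) a₁ a₂ := by
  obtain ⟨M, hM⟩ := exists_forall_apply_one_lt Λ
  have h₁' : a₁ ∉ (Λ : Set (Site 2)) := fun h => h₁ (Finset.mem_coe.1 h)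
  have h₂' : a₂ ∉ (Λ : Set (Site 2)) := fun h => h₂ (Finset.mem_coe.1 h)
  obtain ⟨g₁, hg₁M, hg₁⟩ := hΛ a₁ h₁' M
  obtain ⟨g₂, hg₂M, hg₂⟩ := hΛ a₂ h₂' M
  -- climb both to the common height `H = max (g₁ 1) (g₂ 1)`
  set H : ℤ := max (g₁ 1) (g₂ 1) with hH
  have hc₁ := reflTransGen_faceStep_climb hM h₁' hg₁ hg₁M (H - g₁ 1).toNat
  have hc₂ := reflTransGen_faceStep_climb hM h₂' hg₂ hg₂M (H - g₂ 1).toNat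
  set t₁ : Site 2 := g₁ + (H - g₁ 1).toNat • cornerUnit 1 with ht₁
  set t₂ : Site 2 := g₂ + (H - g₂ 1).toNat • cornerUnit 1 with ht₂
  have ht₁c : t₁ 0 = g₁ 0 ∧ t₁ 1 = H := by
    have h0 := Int.toNat_of_nonneg (sub_nonneg.2 (le_max_left (g₁ 1) (g₂ 1)))
    constructor <;> simp [ht₁, Pi.add_apply] ; omega
  have ht₂c : t₂ 0 = g₂ 0 ∧ t₂ 1 = H := by
    have h0 := Int.toNat_of_nonneg (sub_nonneg.2 (le_max_right (g₁ 1) (g₂ 1)))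
    constructor <;> simp [ht₂, Pi.add_apply] ; omega
  have hHM : M ≤ H := hg₁M.trans (le_max_left _ _)
  -- walk horizontally from `t₁` to `t₂`
  have hwalk : Relation.ReflTransGen (FaceStep (Λ : Set (Site 2))) a₁ t₂ := by
    by_cases hle : g₁ 0 ≤ g₂ 0
    · have hw := reflTransGen_faceStep_horizontal hM h₁' hc₁ (by rw [ht₁c.2]; exact hHM) 0 (Or.inl rfl) (g₂ 0 - g₁ 0).toNat
      convert hw using 1
      have h0 := Int.toNat_of_nonneg (sub_nonneg.2 hle)
      ext i; fin_cases i <;> simp [Pi.add_apply, ht₂c.1, ht₂c.2, ht₁c.1, ht₁c.2] ; omega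
    · push Not at hle
      have hw := reflTransGen_faceStep_horizontal hM h₁' hc₁ (by rw [ht₁c.2]; exact hHM) 2 (Or.inr rfl) (g₁ 0 - g₂ 0).toNat
      convert hw using 1
      have h0 := Int.toNat_of_nonneg (sub_nonneg.2 hle.le)
      ext i; fin_cases i <;> simp [Pi.add_apply, ht₂c.1, ht₂c.2, ht₁c.1, ht₁c.2] ; omega
  exact hwalk.trans (reflTransGen_faceStep_symm hc₂)

/-- A face step between frozen sites is a segment of the frozen skeleton. [folklore] -/
theorem segment_subset_frozenSkeleton_of_faceStep {Λ : Finset (Site 2)} {g g' : Site 2} (h : FaceStep (Λ : Set (Site 2)) g g') :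
    segment ℝ (toComplex g) (toComplex g') ⊆ frozenSkeleton Λ := by
  obtain ⟨k, rfl⟩ := exists_eq_add_cornerUnit h.1
  intro w hw
  exact mem_frozenSkeleton_iff.2 ⟨g, k, ⟨fun hg => h.2.1 (Finset.mem_coe.2 hg), fun hg => h.2.2 (Finset.mem_coe.2 hg)⟩, hw⟩

/-- **A frozen site of a hole-free free set lies on the frozen skeleton** (it has a frozen neighbour). [folklore] -/
theorem toComplex_mem_frozenSkeleton {Λ : Finset (Site 2)} (hΛ : HoleFree (Λ : Set (Site 2))) {a : Site 2} (ha : a ∉ Λ) :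
    toComplex a ∈ frozenSkeleton Λ := by
  have ha' : a ∉ (Λ : Set (Site 2)) := fun h => ha (Finset.mem_coe.1 h)
  obtain ⟨g, hgM, hg⟩ := hΛ a ha' (a 1 + 1)
  rcases Relation.ReflTransGen.cases_head hg with rfl | ⟨c, hac, -⟩
  · omega
  · exact segment_subset_frozenSkeleton_of_faceStep hac (left_mem_segment ℝ _ _)

/-- Polygonal realisation of a face-step chain inside the frozen skeleton. [folklore] -/
theorem exists_path_frozenSkeleton_of_reflTransGen {Λ : Finset (Site 2)} (hΛ : HoleFree (Λ : Set (Site 2))) {a₁ a₂ : Site 2}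
    (h₁ : a₁ ∉ Λ) (h : Relation.ReflTransGen (FaceStep (Λ : Set (Site 2))) a₁ a₂) :
    ∃ γ : Path (toComplex a₁) (toComplex a₂), ∀ t, γ t ∈ frozenSkeleton Λ := by
  induction h with
  | refl => exact ⟨Path.refl _, fun t => by simpa using toComplex_mem_frozenSkeleton hΛ h₁⟩
  | tail _ hst ih =>
    obtain ⟨γ, hγ⟩ := ih
    rename_i b c _
    refine ⟨γ.trans (Path.segment (toComplex b) (toComplex c)), fun t => ?_⟩
    have ht := mem_range_self (f := γ.trans (Path.segment (toComplex b) (toComplex c))) t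
    rw [Path.trans_range, Path.range_segment] at ht
    rcases ht with ⟨t', ht'⟩ | ht
    · rw [← ht']; exact hγ t'
    · exact segment_subset_frozenSkeleton_of_faceStep hst ht

/-- **Any two frozen sites of a hole-free finite free set are joined by a continuous planar path
inside the frozen skeleton.** [cite: ChelkakSmirnov2012Ising, proof of Thm. 6.1 (∂D^δ ∖ C^δ ⊂ ∂Ω^δ)] -/
theorem exists_path_frozenSkeleton {Λ : Finset (Site 2)} (hΛ : HoleFree (Λ : Set (Site 2))) {a₁ a₂ : Site 2}
    (h₁ : a₁ ∉ Λ) (h₂ : a₂ ∉ Λ) : ∃ γ : Path (toComplex a₁) (toComplex a₂), ∀ t, γ t ∈ frozenSkeleton Λ :=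
  exists_path_frozenSkeleton_of_reflTransGen hΛ h₁ (reflTransGen_faceStep_of_holeFree hΛ h₁ h₂)

/-- Every point of the frozen skeleton is within distance `1` of a frozen site: a point at distance
`> 1` from every frozen site misses the skeleton (bulk paths miss it). [folklore] -/
theorem not_mem_frozenSkeleton_of_dist {Λ : Finset (Site 2)} {w : ℂ} (hw : ∀ a : Site 2, a ∉ Λ → 1 < dist w (toComplex a)) :
    w ∉ frozenSkeleton Λ := by
  intro h
  obtain ⟨a, k, ⟨ha, -⟩, hseg⟩ := mem_frozenSkeleton_iff.1 h
  have h1 := hw a ha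
  -- `w` is on the unit segment from `a`, so `dist w a ≤ 1`
  rw [segment_eq_image'] at hseg
  obtain ⟨θ, ⟨hθ0, hθ1⟩, rfl⟩ := hseg
  have : dist (toComplex a + θ • (toComplex (a + cornerUnit k) - toComplex a)) (toComplex a) ≤ 1 := by
    rw [dist_eq_norm, add_sub_cancel_left, norm_smul, Real.norm_eq_abs, abs_of_nonneg hθ0]
    have hn : ‖toComplex (a + cornerUnit k) - toComplex a‖ = 1 := by
      fin_cases k <;> simp [toComplex, Pi.add_apply, Complex.norm_def, Complex.normSq] 
    rw [hn, mul_one]; exact hθ1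
  linarith

end Literature.Probability.LatticeModels
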